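import Literature.ModelTheory.PseudofiniteFields.EtaleOpenTopologyProofs
import HarnessLib

/-!
# Standard étale images: traces on coordinate lines

Topic `Literature/ModelTheory/PseudofiniteFields`.  Proof-only companion of `EtaleOpenTopology.lean`
(images `EtaleDatum.image` of standard étale data `(G_1, …, G_r ; H)` over `K^m`) and of
`EtaleOpenTopologyProofs.lean` (`EtaleDatum.image_infinite_of_nonempty_psf`: over a pseudo-finite
field a nonempty étale image in the affine line is infinite — the case `V = 𝔸¹` of
W. Johnson, C.-M. Tran, E. Walsberg, J. Ye, *The étale-open topology and the stable fields
conjecture*, J. Eur. Math. Soc. 26 (2024) [JohnsonTranWalsbergYe2024], Thm 7.1).  Two results: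

* `EtaleDatum.exists_image_eq_coordinateLine` — for a datum `E` over `K^m`, a point `p ∈ K^m`
  and a coordinate `i`, the trace `{v ∈ K¹ | p + (v₀ - p_i) e_i ∈ E.image}` of the image on the
  coordinate line through `p` in direction `e_i` is the image of a datum over `K¹` with the same
  number of auxiliary variables: substitute `X_i ↦ S` (the line variable), `X_j ↦ p_j` (`j ≠ i`),
  keep the auxiliary variables (the base change of `Spec K[X, T]_{HJ}/(G) → 𝔸^m` along the line
  `𝔸¹ → 𝔸^m`).  Pure algebra over a commutative ring.
* `EtaleDatum.line_trace_infinite_psf` — over a pseudo-finite field `K`, for every point `p` of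
  an étale image `E.image ⊆ K^m` and every coordinate `i`, the set
  `{t ∈ K | (p with p_i replaced by t) ∈ E.image}` is infinite (the line datum has the point
  `p_i`, hence an infinite image by `EtaleDatum.image_infinite_of_nonempty_psf`).  Consequence
  used downstream: a set with finite fibres along a coordinate contains no nonempty basic
  étale-open set.

No named fact is introduced; no new definition is made.

## References

* W. Johnson, C.-M. Tran, E. Walsberg, J. Ye, *The étale-open topology and the stable fields
  conjecture*, J. Eur. Math. Soc. 26 (2024) 4033–4070, §1 (étale images, system of topologies)
  and Thm 7.1. [JohnsonTranWalsbergYe2024]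
* J. Ax, *The elementary theory of finite fields*, Ann. of Math. 88 (1968) 239–271, §§7–8.
  [Ax1968]

## Not here

Traces on general lines `p + s v` or on polynomial curves (same proof with another substitution).
-/

namespace Literature.ModelTheory.PseudofiniteFields

open MvPolynomial FirstOrder FirstOrder.Language FirstOrder.Ring

namespace EtaleDatum

section CommRing

variable {K : Type*} [CommRing K] {m r : ℕ}

/-- **Étale images restrict to coordinate lines**: for every standard étale datum `E` over `K^m`,
every `p ∈ K^m` and every coordinate `i` there is a standard étale datum `E₁` over `K¹`, with the
same number of auxiliary variables, whose image is `{v | Function.update p i (v 0) ∈ E.image}` —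
namely `E` with `X_i ↦ S`, `X_j ↦ p_j` for `j ≠ i`, `T_s ↦ T_s` substituted in all its
polynomials (witness: the same `t`; the substitution commutes with every `∂/∂T_s`, hence with the
Jacobian determinant). [folklore] -/
theorem exists_image_eq_coordinateLine (E : EtaleDatum K m r) (p : Fin m → K) (i : Fin m) :
    ∃ E₁ : EtaleDatum K 1 r, E₁.image = {v | Function.update p i (v 0) ∈ E.image} := by
  classical
  -- the substitution `X_i ↦ S`, `X_j ↦ p_j` (`j ≠ i`), `T_s ↦ T_s`
  let f : Fin m ⊕ Fin r → MvPolynomial (Fin 1 ⊕ Fin r) K :=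
    Sum.elim (fun j => if j = i then X (Sum.inl 0) else C (p j)) (fun s => X (Sum.inr s))
  have heval : ∀ (v : Fin 1 → K) (t : Fin r → K) (q : MvPolynomial (Fin m ⊕ Fin r) K),
      eval (Sum.elim v t) (aeval f q) = eval (Sum.elim (Function.update p i (v 0)) t) q := by
    intro v t q
    induction q using MvPolynomial.induction_on with
    | C a => rw [aeval_C, algebraMap_eq, eval_C, eval_C]
    | add p q hp hq => rw [map_add, map_add, map_add, hp, hq]
    | mul_X q n hq =>
      rw [map_mul, map_mul, map_mul, hq, aeval_X, eval_X]
      congr 1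
      rcases n with j | s
      · by_cases h : j = i
        · subst h
          simp only [f, Sum.elim_inl, ↓reduceIte, eval_X, Function.update_self]
        · simp only [f, Sum.elim_inl, if_neg h, eval_C, Function.update_of_ne h]
      · simp only [f, Sum.elim_inr, eval_X]
  have hpd : ∀ (s : Fin r) (q : MvPolynomial (Fin m ⊕ Fin r) K),
      pderiv (Sum.inr s) (aeval f q) = aeval f (pderiv (Sum.inr s) q) := fun s =>
    pderiv_aeval_eq_aeval_pderiv f (Sum.inr s) (Sum.inr s) fun n => by
      rcases n with j | s'
      · by_cases h : j = i
        · subst h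
          simp [f, pderiv_X_of_ne (show (Sum.inl 0 : Fin 1 ⊕ Fin r) ≠ Sum.inr s from
            Sum.inl_ne_inr)]
        · simp [f, h]
      · by_cases h : s' = s
        · subst h
          simp [f]
        · simp [f, h, pderiv_X_of_ne (show (Sum.inr s' : Fin 1 ⊕ Fin r) ≠ Sum.inr s from
            fun e => h (Sum.inr_injective e))]
  have hjac : jacobianDet (⟨fun l => aeval f (E.G l), aeval f E.H⟩ : EtaleDatum K 1 r) =
      aeval f E.jacobianDet := by
    rw [jacobianDet, jacobianDet, AlgHom.map_det, AlgHom.mapMatrix_apply]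
    congr 1
    exact Matrix.ext fun l s => by simp only [Matrix.of_apply, Matrix.map_apply, hpd]
  refine ⟨⟨fun l => aeval f (E.G l), aeval f E.H⟩, Set.ext fun v => ?_⟩
  rw [Set.mem_setOf_eq, mem_image_iff, mem_image_iff, hjac]
  simp only [heval]

end CommRing

section PseudoFinite

/-- **The trace of an étale image on a coordinate line through one of its points is infinite
(pseudo-finite fields).**  For `K` an infinite model of the theory of finite fields, a standard
étale datum `E` over `K^m`, a point `p ∈ E.image` and a coordinate `i`, the set of `t ∈ K` with
`(p_1, …, p_{i-1}, t, p_{i+1}, …, p_m) ∈ E.image` is infinite: it is (the first coordinate of)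
the image of the line datum of `EtaleDatum.exists_image_eq_coordinateLine`, which contains `p_i`,
and nonempty étale images in `𝔸¹(K)` are infinite (`EtaleDatum.image_infinite_of_nonempty_psf`,
the case `V = 𝔸¹` of Johnson–Tran–Walsberg–Ye's Theorem 7.1 over pseudo-finite fields).
[cite: JohnsonTranWalsbergYe2024, Thm 7.1] [cite: Ax1968, §§7–8] -/
theorem line_trace_infinite_psf (K : Type) [Field K] [CompatibleRing K] [Infinite K]
    (hK : K ⊨ finiteFieldTheory) {m r : ℕ} (E : EtaleDatum K m r) (p : Fin m → K)
    (hp : p ∈ E.image) (i : Fin m) :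
    {t : K | Function.update p i t ∈ E.image}.Infinite := by
  obtain ⟨E₁, hE₁⟩ := E.exists_image_eq_coordinateLine p i
  have hne : E₁.image.Nonempty :=
    ⟨fun _ => p i, by rw [hE₁, Set.mem_setOf_eq, Function.update_eq_self]; exact hp⟩
  refine Set.infinite_of_injOn_mapsTo (f := fun v : Fin 1 → K => v 0) ?_ ?_
    (image_infinite_of_nonempty_psf K hK E₁ hne)
  · exact Set.injOn_of_injective
      (fun v w h => funext fun j => by rw [Fin.fin_one_eq_zero j]; exact h)
  · intro v hv
    rw [hE₁] at hv
    exact hv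

end PseudoFinite

end EtaleDatum

end Literature.ModelTheory.PseudofiniteFields
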